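import Summits.Ventures.CertifiedArithmetic.LowPrec.GemmFirstRegimeE2M1Law
import HarnessLib

/-!
# E2M1·E2M1 products accumulated in binary16: the first-regime law in the kernel, by range transfer

HONEST FRAMING (venture CertifiedArithmetic / cell `pub-lowprec`): certified error envelopes and
provably optimal rounding/accumulation schemes for low-precision formats under stated cost models;
every table by two implementations; no hardware or vendor claims.

`gemm.tex` Prop. p:fp16: for products of two E2M1 values accumulated sequentially in IEEE
`binary16` (`p = 11`, round-to-nearest-even) the worst relative error `W_11(n)` over all words of
`n` letters of `Π(E2M1,E2M1)` is `0` for `n ≤ 15` and `(n-15)/(2033+n)` for `16 ≤ n ≤ 1039`.  The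
all-precision theorems of `GemmFirstRegimeE2M1.lean` / `GemmFirstRegimeE2M1Law.lean` (exact range
`worstP_eq_zero`, restart bound `worstP_le_firstRegime`, attainment and equality
`worstP_firstRegime` for `p ≡ 0,3,4,5 (mod 6)` — `p = 11 ≡ 5`, `T = 2^11 = 144·14 + 32`, letters
`(8, ¼)`) would give this at once, except that they carry the crude range hypothesis
`2^(m+10) ≤ maxRat`, which `binary16` (`maxRat = 65504 < 2^20`) fails.

This file removes the obstruction by a RANGE TRANSFER (no re-proof of the regime theorems):
* `toRat_roundNE_eq_of_wider`: two formats with the same significand width and bias (hence the same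
  quantum) and nested exponent ranges round every `|q| < maxRat` of the smaller one to the same
  value (the binade search `Format.shiftAux` is fuel-independent below `2^(m+1+fuel)`,
  `shiftAux_fuel_indep`; no saturation on either side); hence accumulations whose arguments stay
  inside the smaller range agree (`seqSum_toRat_eq_of_wider`).
* a widened `binary16` (`exists_binary16Wide`: exponent codes `0 … 62`, `maxRat = 2047·2^37 ≥ 2^20`;
  no new definition, the theorems of section `Wide` are stated for any such `ψ`) meets the
  all-precision hypotheses; the a-priori accumulator bound `|ŝ_j| ≤ (3/2)·Σ_{i≤j}|x_i|` in the first
  regime (`abs_seqSum_le_firstRegime`, from the exact prefix and the restart bound `k/(T+k) ≤ ½`)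
  keeps every argument of a word of `≤ 1039` letters below `54·1038 + 36 < 65504`
  (`E2M1_args_lt_Binary16_maxRat`), so `W_binary16(n) = W_ψ(n)` for `n ≤ 1039`
  (`worstP_Binary16_eq_wide`).
* Instances: `worstP_Binary16_eq_zero` (`n ≤ 15`), `worstP_Binary16_firstRegime`
  (`W_11(15+k) = k/(2^11+k)`, `1 ≤ k ≤ 2^10`), `worstP_Binary16_law` (the paper's form
  `(n-15)/(2033+n)`, `16 ≤ n ≤ 1039`), `worstP_Binary16_first` (`W_11(16) = 1/2049`).

Prop. p:fp16 was a paper proof (the certified rows of `GEMM-BOUNDS.md` §4, two implementations,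
agree with it where tabulated; its lower family is `TieChain.fp16_512_ratio`, every `n ≥ 15`); it
is now kernel-checked on its whole stated range `n ≤ 1039`.  Lengths `n ≥ 1040` lie beyond the
hypothesis `k ≤ 2^(p-1)` of the restart bound and are not treated.  No numerics in this file;
`decide` only on format constants.
-/

namespace Summit.Ventures.CertifiedArithmetic.LowPrec.Gemm

open Literature.ComputerArithmetic.FloatingPoint
open Literature.ComputerArithmetic.FloatingPoint.MiniFloat
open Finset

/-! ### Range transfer between a format and the same format with more exponent range -/

/-- The binade search `shiftAux m n fuel` does not depend on its fuel below `2^(m+1+fuel)`.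
[folklore] -/
theorem shiftAux_fuel_indep (m : ℕ) : ∀ (fuel n fuel' : ℕ),
    n < 2 ^ (m + 1 + fuel) → fuel ≤ fuel' → Format.shiftAux m n fuel' = Format.shiftAux m n fuel
  | 0, n, fuel', hn, _ => by
      rw [Format.shiftAux_eq_zero_of_lt m fuel' (by simpa using hn),
        Format.shiftAux_eq_zero_of_lt m 0 (by simpa using hn)]
  | fuel + 1, n, fuel', hn, hle => by
      obtain ⟨f, rfl⟩ : ∃ f, fuel' = f + 1 := ⟨fuel' - 1, by omega⟩
      by_cases h : n < 2 ^ (m + 1)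
      · rw [Format.shiftAux_eq_zero_of_lt m _ h, Format.shiftAux_eq_zero_of_lt m _ h]
      · simp only [Format.shiftAux, if_neg h]
        have hn' : n / 2 < 2 ^ (m + 1 + fuel) := by
          have : 2 ^ (m + 1 + (fuel + 1)) = 2 ^ (m + 1 + fuel) * 2 := by ring
          omega
        rw [shiftAux_fuel_indep m fuel (n / 2) f hn' (by omega)]

/-- SAME PRECISION, MORE RANGE: if `ψ` has the significand width and the bias of `φ` (hence its
quantum) and at least its exponent range, then every `|q| < maxRat φ` rounds (RNE) to the same value
in `φ` and in `ψ` — neither side saturates and the local spacings agree. [folklore] -/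
theorem toRat_roundNE_eq_of_wider {φ ψ : Format} (hmb : ψ.manBits = φ.manBits)
    (hb : ψ.bias = φ.bias) (he : φ.emaxCode ≤ ψ.emaxCode) (h1 : 1 ≤ φ.emaxCode)
    (hM : φ.maxRat ≤ ψ.maxRat) {q : ℚ} (hq : |q| < φ.maxRat) :
    (roundNE φ q).toRat = (roundNE ψ q).toRat := by
  have hquant : ψ.quantum = φ.quantum := by
    unfold Format.quantum Format.qexp; rw [hmb, hb]
  have hovφ : overflowNE φ q = false := by
    cases h : overflowNE φ q
    · rfl
    · exact absurd (maxRat_le_abs_of_overflow h) (not_le.mpr hq)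
  have hovψ : overflowNE ψ q = false := by
    cases h : overflowNE ψ q
    · rfl
    · exact absurd (maxRat_le_abs_of_overflow h) (not_le.mpr (lt_of_lt_of_le hq hM))
  have hgφ := rneGrid_eq_rneMult_of_not_overflow hovφ
  have hgψ := rneGrid_eq_rneMult_of_not_overflow hovψ
  rw [hquant] at hgψ
  -- the binade shifts agree
  have hr0 : 0 ≤ |q| / φ.quantum := div_nonneg (abs_nonneg q) φ.quantum_pos.le
  have hn : ⌊|q| / φ.quantum⌋.toNat < 2 ^ (φ.manBits + 1 + (φ.emaxCode - 1)) := by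
    rw [show φ.manBits + 1 + (φ.emaxCode - 1) = φ.manBits + φ.emaxCode by omega]
    have hq' := hq
    unfold Format.maxRat at hq'
    have hlt : |q| / φ.quantum < φ.maxScaled := by rwa [div_lt_iff₀ φ.quantum_pos]
    have hms : ((φ.maxScaled : ℕ) : ℚ) < 2 ^ (φ.manBits + φ.emaxCode) := by
      exact_mod_cast Format.maxScaled_lt_pow h1
    have := lt_of_le_of_lt (Format.floor_toNat_le hr0) (lt_trans hlt hms)
    exact_mod_cast this
  have hshift : ψ.shift ⌊|q| / φ.quantum⌋.toNat = φ.shift ⌊|q| / φ.quantum⌋.toNat := by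
    unfold Format.shift; rw [hmb]
    exact shiftAux_fuel_indep φ.manBits (φ.emaxCode - 1) _ (ψ.emaxCode - 1) hn (by omega)
  have hmult : ψ.rneMult (|q| / φ.quantum) = φ.rneMult (|q| / φ.quantum) := by
    unfold Format.rneMult; rw [hshift]
  rw [toRat_roundNE, toRat_roundNE, hquant, hgφ, hgψ, hmult]

/-- … hence an accumulation whose arguments, when run in `ψ`, stay strictly inside the range of `φ`
returns the same values in `φ`. [folklore] -/
theorem seqSum_toRat_eq_of_wider {φ ψ : Format} (hmb : ψ.manBits = φ.manBits)
    (hb : ψ.bias = φ.bias) (he : φ.emaxCode ≤ ψ.emaxCode) (h1 : 1 ≤ φ.emaxCode)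
    (hM : φ.maxRat ≤ ψ.maxRat) {x : ℕ → ℚ} (hx0 : |x 0| < φ.maxRat) :
    ∀ m : ℕ, (∀ j < m, |(seqSum ψ x j).toRat + x (j + 1)| < φ.maxRat) →
      (seqSum φ x m).toRat = (seqSum ψ x m).toRat
  | 0, _ => by
      simp only [seqSum]
      exact toRat_roundNE_eq_of_wider hmb hb he h1 hM hx0
  | m + 1, hstep => by
      simp only [seqSum]
      rw [seqSum_toRat_eq_of_wider hmb hb he h1 hM hx0 m fun j hj => hstep j (by omega)]
      exact toRat_roundNE_eq_of_wider hmb hb he h1 hM (hstep m (by omega))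

/-- A word of zeros accumulates to zero. [folklore] -/
theorem seqSum_toRat_eq_zero_of_zero {φ : Format} {x : ℕ → ℚ} :
    ∀ m : ℕ, (∀ i ≤ m, x i = 0) → (seqSum φ x m).toRat = 0
  | 0, h => by
      simp only [seqSum]
      rw [h 0 le_rfl]
      exact toRat_roundNE_zero
  | m + 1, h => by
      simp only [seqSum]
      rw [seqSum_toRat_eq_zero_of_zero m fun i hi => h i (by omega), h (m + 1) le_rfl, add_zero]
      exact toRat_roundNE_zero

/-! ### A-priori size of the accumulator in the first regime (every precision) -/

section Regime

variable {φ : Format}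
variable (hm : 7 ≤ φ.manBits) (hq : φ.qexp ≤ -2) (hR : (2 : ℚ) ^ (φ.manBits + 10) ≤ φ.maxRat)
include hm hq hR

/-- For every word over the alphabet and every `j ≤ j₀ + 2^manBits` (`144 j₀ < T`):
`|ŝ_j| ≤ (3/2)·Σ_{i≤j} |x_i|` — the prefix is exact up to `j₀` (`seqSum_exact_prefix`) and the
relative error is at most `k/(T+k) ≤ ½` afterwards (`relErr_le_firstRegime`). [cell] -/
theorem abs_seqSum_le_firstRegime {x : ℕ → ℚ} (hx : ∀ j, x j ∈ piE2M1) {j0 : ℕ}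
    (hj0 : 144 * j0 < 2 ^ (φ.manBits + 1)) {j : ℕ} (hj : j ≤ j0 + 2 ^ φ.manBits) :
    |(seqSum φ x j).toRat| ≤ 3 / 2 * ∑ i ∈ range (j + 1), |x i| := by
  have hL0 : 0 ≤ ∑ i ∈ range (j + 1), |x i| := sum_nonneg fun i _ => abs_nonneg _
  have hS : |∑ i ∈ range (j + 1), x i| ≤ ∑ i ∈ range (j + 1), |x i| := abs_sum_le_sum_abs _ _
  have hrel : relErr φ x j ≤ 1 / 2 := by
    rcases Nat.lt_or_ge j0 j with hlt | hle
    swap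
    · unfold relErr
      rw [seqSum_exact_prefix hm hq hR hx hj0 j hle, sub_self, abs_zero, zero_div]
      norm_num
    · obtain ⟨k, rfl⟩ : ∃ k, j = j0 + k := ⟨j - j0, by omega⟩
      have hk : k ≤ 2 ^ φ.manBits := by omega
      refine le_trans (relErr_le_firstRegime hm hq hR hx hj0 hk) ?_
      have hkq : (k : ℚ) ≤ 2 ^ φ.manBits := by exact_mod_cast hk
      have hT : (2 : ℚ) ^ (φ.manBits + 1) = 2 * 2 ^ φ.manBits := by ring
      rw [div_le_iff₀ (by positivity), hT]
      linarith
  by_cases hL : ∑ i ∈ range (j + 1), |x i| = 0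
  · have hz : ∀ i ≤ j, x i = 0 := by
      intro i hi
      have := (sum_eq_zero_iff_of_nonneg fun i _ => abs_nonneg (x i)).mp hL i
        (mem_range.mpr (by omega))
      exact abs_eq_zero.mp this
    rw [seqSum_toRat_eq_zero_of_zero j hz, abs_zero]
    positivity
  · have hLpos : 0 < ∑ i ∈ range (j + 1), |x i| := lt_of_le_of_ne hL0 (Ne.symm hL)
    have hE : |(seqSum φ x j).toRat - ∑ i ∈ range (j + 1), x i|
        ≤ 1 / 2 * ∑ i ∈ range (j + 1), |x i| := by
      unfold relErr at hrel
      rwa [div_le_iff₀ hLpos] at hrel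
    have := abs_sub_abs_le_abs_sub (seqSum φ x j).toRat (∑ i ∈ range (j + 1), x i)
    linarith

end Regime

/-! ### binary16 inside a widened format -/

section Wide

/- `ψ` is "`binary16` with more exponent range": significand width `10` and bias `15` as `binary16`
(hence the same quantum `2^-24` and the same values below `65504`), at least its exponent codes,
and a range meeting the all-precision hypothesis `2^(m+10) ≤ maxRat` (which `binary16` itself,
`maxRat = 65504 < 2^20`, fails).  Such a `ψ` exists: `exists_binary16Wide` (codes `0 … 62`). -/
variable {ψ : Format} (hmb : ψ.manBits = Format.Binary16.manBits) (hb : ψ.bias = Format.Binary16.bias)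
  (he : Format.Binary16.emaxCode ≤ ψ.emaxCode) (hM : Format.Binary16.maxRat ≤ ψ.maxRat)
  (hq : ψ.qexp ≤ -2) (hR : (2 : ℚ) ^ (ψ.manBits + 10) ≤ ψ.maxRat)
include hmb hb he hM hq hR

omit hb he hM in
/-- IN RANGE: every word of at most `1039` letters of `Π(E2M1,E2M1)`, accumulated in the widened
format, keeps every argument of the rounding below `54·1038 + 36 < 65504 = maxRat(binary16)` in
magnitude. [cell] -/
theorem E2M1_args_lt_Binary16_maxRat {x : ℕ → ℚ} (hx : ∀ j, x j ∈ piE2M1) {j : ℕ}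
    (hj : j ≤ 1037) :
    |(seqSum ψ x j).toRat + x (j + 1)| < Format.Binary16.maxRat := by
  have hm10 : ψ.manBits = 10 := hmb
  have hE := abs_seqSum_le_firstRegime (by omega) hq hR hx (j0 := 14) (by rw [hm10]; norm_num)
    (j := j) (by rw [hm10]; norm_num; omega)
  have hL := sum_abs_le hx (j + 1)
  have hx1 := abs_letter_le _ (hx (j + 1))
  have hjq : ((j + 1 : ℕ) : ℚ) ≤ 1038 := by exact_mod_cast (by omega : j + 1 ≤ 1038)
  rw [Format.Binary16_maxRat.1]
  calc |(seqSum ψ x j).toRat + x (j + 1)|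
      ≤ |(seqSum ψ x j).toRat| + |x (j + 1)| := abs_add_le _ _
    _ ≤ 3 / 2 * (36 * ((j + 1 : ℕ) : ℚ)) + 36 := by linarith
    _ < 65504 := by linarith

/-- THE TRANSFER: for every word over the alphabet and every `m ≤ 1038` (`n ≤ 1039` letters) the
`binary16` accumulation and the widened one return the same values. [cell] -/
theorem seqSum_Binary16_eq_wide {x : ℕ → ℚ} (hx : ∀ j, x j ∈ piE2M1) {m : ℕ} (hm : m ≤ 1038) :
    (seqSum Format.Binary16 x m).toRat = (seqSum ψ x m).toRat := by
  have hx0 : |x 0| < Format.Binary16.maxRat := by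
    rw [Format.Binary16_maxRat.1]
    exact lt_of_le_of_lt (abs_letter_le _ (hx 0)) (by norm_num)
  exact seqSum_toRat_eq_of_wider hmb hb he (by decide) hM hx0 m fun j hj =>
    E2M1_args_lt_Binary16_maxRat hmb hq hR hx (by omega)

/-- … so the relative errors agree, [cell] -/
theorem relErr_Binary16_eq_wide {x : ℕ → ℚ} (hx : ∀ j, x j ∈ piE2M1) {m : ℕ} (hm : m ≤ 1038) :
    relErr Format.Binary16 x m = relErr ψ x m := by
  unfold relErr
  rw [seqSum_Binary16_eq_wide hmb hb he hM hq hR hx hm]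

/-- … and so do the worst cases: `W_binary16(n) = W_ψ(n)` for `n = m + 1 ≤ 1039`.
[cell, gemm.tex Prop. p:fp16] -/
theorem worstP_Binary16_eq_wide {m : ℕ} (hm : m ≤ 1038) :
    worstRelErrE2M1 Format.Binary16 m = worstRelErrE2M1 ψ m := by
  unfold worstRelErrE2M1
  congr 1
  funext w
  exact relErr_Binary16_eq_wide hmb hb he hM hq hR (wordInput_mem w) hm

end Wide

/-- A WIDENED binary16 EXISTS: exponent codes `0 … 62`, `maxRat = 2047·2^37`.
[cite: IEEE7542019, Table 3.5] -/
theorem exists_binary16Wide : ∃ ψ : Format, ψ.manBits = Format.Binary16.manBits ∧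
    ψ.bias = Format.Binary16.bias ∧ Format.Binary16.emaxCode ≤ ψ.emaxCode ∧
    Format.Binary16.maxRat ≤ ψ.maxRat ∧ ψ.qexp ≤ -2 ∧ (2 : ℚ) ^ (ψ.manBits + 10) ≤ ψ.maxRat := by
  have hW : (⟨10, 15, 62, 2 ^ 10 - 1, by decide⟩ : Format).maxRat = 2047 * 2 ^ 37 := by
    decide +kernel
  refine ⟨⟨10, 15, 62, 2 ^ 10 - 1, by decide⟩, rfl, rfl, by decide, ?_, by decide, ?_⟩
  · rw [hW, Format.Binary16_maxRat.1]; norm_num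
  · rw [hW]; norm_num

/-! ### Prop. p:fp16 in the kernel -/

/-- `W_11(n) = 0` FOR EVERY `n ≤ 15` (E2M1·E2M1 products, sequential binary16 accumulation, RNE):
index `m = n - 1 ≤ 14`. [cell, gemm.tex Prop. p:fp16] -/
theorem worstP_Binary16_eq_zero {m : ℕ} (hm : m ≤ 14) : worstRelErrE2M1 Format.Binary16 m = 0 := by
  obtain ⟨ψ, hmb, hb, he, hM, hq, hR⟩ := exists_binary16Wide
  have hm10 : ψ.manBits = 10 := hmb
  rw [worstP_Binary16_eq_wide hmb hb he hM hq hR (by omega)]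
  exact worstP_eq_zero (by omega) hq hR (by rw [hm10]; norm_num; omega)

/-- THE EXACT WORST CASE OF FP4 PRODUCTS ACCUMULATED IN binary16, `16 ≤ n ≤ 1039`:
`W_11(15 + k) = k/(2^11 + k)` (`= ku/(1+ku)`, `u = 2^-11`) for every `1 ≤ k ≤ 2^10` (index
`m = 14 + k`), attained by `8, ¼, 36^{×14}, ¼^{×(k-1)}`. [cell, gemm.tex Prop. p:fp16] -/
theorem worstP_Binary16_firstRegime {k : ℕ} (hk : 1 ≤ k) (hk' : k ≤ 1024) :
    worstRelErrE2M1 Format.Binary16 (14 + k) = (k : ℚ) / (2 ^ 11 + k) := by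
  obtain ⟨ψ, hmb, hb, he, hM, hq, hR⟩ := exists_binary16Wide
  have hm10 : ψ.manBits = 10 := hmb
  rw [worstP_Binary16_eq_wide hmb hb he hM hq hR (by omega)]
  have hk'' : k ≤ 2 ^ ψ.manBits := by rw [hm10]; norm_num; omega
  have h := worstP_firstRegime (by omega) hq hR (j0 := 14) (A := 32) (B := 1)
    (by norm_num [piE2M1]) (by norm_num [piE2M1]) (by rw [hm10]; norm_num)
    (by rw [hm10]; norm_num) hk hk''
  rw [h, hm10]

/-- Prop. p:fp16 in the paper's variable: `W_11(n) = (n - 15)/(2033 + n)` for every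
`16 ≤ n ≤ 1039` (index `m = n - 1`). [cell, gemm.tex Prop. p:fp16] -/
theorem worstP_Binary16_law {n : ℕ} (hn : 16 ≤ n) (hn' : n ≤ 1039) :
    worstRelErrE2M1 Format.Binary16 (n - 1) = ((n : ℚ) - 15) / (2033 + n) := by
  obtain ⟨k, rfl⟩ : ∃ k, n = 15 + k := ⟨n - 15, by omega⟩
  rw [show 15 + k - 1 = 14 + k by omega, worstP_Binary16_firstRegime (by omega) (by omega)]
  push_cast
  rw [div_eq_div_iff (by positivity) (by positivity)]
  ring

/-- The first nonzero value: `W_11(16) = 1/2049`. [cell, gemm.tex Prop. p:fp16] -/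
theorem worstP_Binary16_first : worstRelErrE2M1 Format.Binary16 15 = 1 / 2049 := by
  rw [show (15 : ℕ) = 14 + 1 from rfl, worstP_Binary16_firstRegime le_rfl (by norm_num)]
  norm_num

end Summit.Ventures.CertifiedArithmetic.LowPrec.Gemm
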